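import Mathlib
import Summits.ValiantsHypothesis.ValiantsHypothesis.Theses.LacunarySymmetroid
import Summits.ValiantsHypothesis.ValiantsHypothesis.Theorems.LacunarySymmetroidDoorA26ExtremalInverseDefs
import Summits.ValiantsHypothesis.ValiantsHypothesis.Theorems.LacunarySymmetroidDoorA26ExtremalInverseStubExtremalInverse

/-!
# Route `LacunarySymmetroid` — crux `DoorA26` (stmt-ValiantsHypothesis-19979), line «extremal-inverse»:
# the Gram form, the one-positive lemma, and the REDUCTION `signature law at K = 6 ⇒ DoorA26` (kernel-checked, Theorems side)

Line `Cruxes/DoorA26/Lines/extremal_inverse.lean` (ideator val-idea-4 g2, D-0145) composes the crux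
`DoorA26 = PosRootLawAt 2 6 19` (`ζ_sym(2,6) ≤ 19`) from four statements: the Gram form (`stub_gramForm`), the extremal
inverse (`stub_extremalInverse`, LANDED: `…DoorA26ExtremalInverseStubExtremalInverse`), the one-positive lemma
(`stub_onePositive`) and the load-bearing SIGNATURE LAW `stub_signatureLaw6` (OPEN — the line's bet).  The first and third
were proved inside the ideator's line file v3 (HOME `ideators/val-idea-4/lines/g2/line-extremal-inverse.lean`, theorems
`gramForm`, `onePositive`); this file carries those proofs to the Theorems side VERBATIM (credit: val-idea-4 g2), under both
the v2 stub names and the v3 names, and lands the line's composition as ONE implication with the signature law as an explicit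
hypothesis:

* `stub_gramForm` / `gramForm` — `det (Σ_l X^{d_l} S_l) = gramPoly d (gram S)` and `IsSymmetroidGram (gram S)` for symmetric
  `2 × 2` blocks (`Matrix.det_fin_two`, distributing the double sum, `v = (a+c)/2`, `u = (a−c)/2`, `w = b`);
* `stub_onePositive` / `onePositive` — a symmetroid Gram `v vᵀ − u uᵀ − w wᵀ` is never `TwoPositive` (`n₊ ≤ 1`: for `x, y`
  of positive `M`-norm with `xᵀ M y = 0`, `z = (v⬝y) x − (v⬝x) y` has `v ⬝ z = 0` so `zᵀ M z ≤ 0`, against bilinearity);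
* `doorA26_of_signatureLaw6` — **if every `K = 6` would-be Gram `extremalGram E σ r c` (Sidon support, sorted positive
  roots, `c ≠ 0`) is `TwoPositive`, then `Summit.….Theses.LacunarySymmetroid.DoorA26`** (the route decl BY NAME):
  Gram form ∘ extremal inverse ∘ one-positive.  Also `not_isSymmetroidGram_extremalGram_of_signatureLaw6` (the would-be-Gram
  form of the door under the law).

HONEST FRAMING.  `DoorA26` is NOT proved here: `doorA26_of_signatureLaw6` is CONDITIONAL on the signature law, which is OPEN
(evidence only: 0 of 8 034 sampled `K = 6` would-be Grams have `min(n₊,n₋) ≤ 1`; crit-1 VERDICT #17 PASS-WITH-PRICE); the file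
closes no item (`--supports stmt-ValiantsHypothesis-19979`, helper).  Nothing bears on `MatrixDescartes`
(stmt-ValiantsHypothesis-18050), Conjecture B, or `VP ≠ VNP`.  Width seat val-width-19979-ei1 (cell valiant-width), 2026-08-28.
[folklore] linear algebra; no citation needed.
-/

-- `Summit.ValiantsHypothesis.ValiantsHypothesis.…` repeats a component by the D-0017 layout
-- (single-conjunct summit), which the `dupNamespace` linter flags; the name is mandated.
set_option linter.dupNamespace false

namespace Summit.ValiantsHypothesis.ValiantsHypothesis.Theorems.LacunarySymmetroid.DoorA26.ExtremalInverse

open Polynomial Matrix Finset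
open scoped BigOperators

/-! ### 1. The Gram form (stub A of the line; proof of val-idea-4 g2, line file v3) -/

/-- `gram S` has the symmetroid inertia: `v = (a+c)/2`, `u = (a−c)/2`, `w = b`. [folklore] -/
theorem gram_isSymmetroidGram (S : Fin 6 → Matrix (Fin 2) (Fin 2) ℝ) : IsSymmetroidGram (gram S) := by
  refine ⟨fun i => (S i 0 0 + S i 1 1) / 2, fun i => (S i 0 0 - S i 1 1) / 2, fun i => S i 0 1, ?_⟩
  ext i j
  simp only [gram, Matrix.of_apply, Matrix.sub_apply, Matrix.vecMulVec_apply]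
  ring

/-- Entries of the pencil `Σ_l X^{d_l} S_l`. [folklore] -/
theorem pencil_apply (d : Fin 6 → ℕ) (S : Fin 6 → Matrix (Fin 2) (Fin 2) ℝ) (i j : Fin 2) :
    (∑ l, (X : ℝ[X]) ^ d l • (S l).map Polynomial.C) i j = ∑ l, X ^ d l * Polynomial.C (S l i j) := by
  simp [Matrix.sum_apply, Matrix.smul_apply, Matrix.map_apply, smul_eq_mul]

/-- `det (Σ_l X^{d_l} S_l) = Σ_{i,j} C (gram S i j) · X^{dᵢ+dⱼ}` for symmetric `2 × 2` blocks. [folklore] -/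
theorem det_eq_gramPoly (d : Fin 6 → ℕ) (S : Fin 6 → Matrix (Fin 2) (Fin 2) ℝ) (hS : ∀ l, (S l).IsSymm) :
    (∑ l, (X : ℝ[X]) ^ d l • (S l).map Polynomial.C).det = gramPoly d (gram S) := by
  have hb : ∀ l, S l 1 0 = S l 0 1 := fun l => by
    simpa using congrFun (congrFun (hS l) 0) 1
  rw [Matrix.det_fin_two, pencil_apply, pencil_apply, pencil_apply, pencil_apply]
  simp_rw [hb]
  rw [Finset.sum_mul_sum, Finset.sum_mul_sum, ← Finset.sum_sub_distrib]
  simp_rw [← Finset.sum_sub_distrib]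
  have hL : ∀ i j : Fin 6, (X : ℝ[X]) ^ d i * C (S i 0 0) * (X ^ d j * C (S j 1 1)) -
      X ^ d i * C (S i 0 1) * (X ^ d j * C (S j 0 1))
      = C (S i 0 0 * S j 1 1 - S i 0 1 * S j 0 1) * X ^ (d i + d j) := by
    intro i j; simp only [map_mul, map_sub, pow_add]; ring
  simp_rw [hL]
  unfold gramPoly gram
  simp only [Matrix.of_apply]
  have hsym : ∑ i, ∑ j, C (S j 0 0 * S i 1 1) * (X : ℝ[X]) ^ (d i + d j)
      = ∑ i, ∑ j, C (S i 0 0 * S j 1 1) * X ^ (d i + d j) := by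
    rw [Finset.sum_comm]
    simp only [add_comm]
  have hR : ∀ i j : Fin 6, C ((S i 0 0 * S j 1 1 + S j 0 0 * S i 1 1) / 2 - S i 0 1 * S j 0 1) * (X : ℝ[X]) ^ (d i + d j)
      = C ((2 : ℝ)⁻¹) * (C (S i 0 0 * S j 1 1) * X ^ (d i + d j)) + C ((2 : ℝ)⁻¹) * (C (S j 0 0 * S i 1 1) * X ^ (d i + d j))
        - C (S i 0 1 * S j 0 1) * X ^ (d i + d j) := by
    intro i j
    simp only [div_eq_mul_inv, map_sub, map_add, map_mul]
    ring
  simp_rw [hR, Finset.sum_sub_distrib, Finset.sum_add_distrib, ← Finset.mul_sum, hsym]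
  have hL2 : ∀ i j : Fin 6, C (S i 0 0 * S j 1 1 - S i 0 1 * S j 0 1) * (X : ℝ[X]) ^ (d i + d j)
      = C (S i 0 0 * S j 1 1) * X ^ (d i + d j) - C (S i 0 1 * S j 0 1) * X ^ (d i + d j) := by
    intro i j; simp only [map_sub]; ring
  simp_rw [hL2, Finset.sum_sub_distrib]
  have h2 : (C ((2 : ℝ)⁻¹) : ℝ[X]) * 2 = 1 := by
    rw [show (2 : ℝ[X]) = C (2 : ℝ) from (map_ofNat C 2).symm, ← map_mul, inv_mul_cancel₀ (two_ne_zero), map_one]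
  linear_combination (-(∑ i, ∑ j, C (S i 0 0 * S j 1 1) * (X : ℝ[X]) ^ (d i + d j))) * h2

/-- **Stub A of the line (`stub_gramForm`, size S), verbatim: the Gram form.**  The determinant of a symmetric `2 × 2`
six-term pencil is the quadratic-form fewnomial of its Gram matrix, and that matrix has the symmetroid inertia.
(Proof of ideator val-idea-4 g2, line file v3, carried to the Theorems side.) [folklore] -/
theorem stub_gramForm :
    ∀ (d : Fin 6 → ℕ) (S : Fin 6 → Matrix (Fin 2) (Fin 2) ℝ), (∀ l, (S l).IsSymm) →
      (∑ l, (X : ℝ[X]) ^ d l • (S l).map Polynomial.C).det = gramPoly d (gram S) ∧ IsSymmetroidGram (gram S) :=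
  fun d S hS => ⟨det_eq_gramPoly d S hS, gram_isSymmetroidGram S⟩

/-- The Gram form under its v3 name `gramForm` (same statement as `stub_gramForm`). [folklore] -/
theorem gramForm :
    ∀ (d : Fin 6 → ℕ) (S : Fin 6 → Matrix (Fin 2) (Fin 2) ℝ), (∀ l, (S l).IsSymm) →
      (∑ l, (X : ℝ[X]) ^ d l • (S l).map Polynomial.C).det = gramPoly d (gram S) ∧ IsSymmetroidGram (gram S) :=
  stub_gramForm

/-! ### 2. A symmetroid Gram has at most one positive eigenvalue (stub C₁; proof of val-idea-4 g2, line file v3) -/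

/-- Bilinear form of a rank-one matrix: `z₁ᵀ (a bᵀ) z₂ = (z₁⬝a)(z₂⬝b)`. [folklore] -/
theorem dot_vecMulVec_mulVec (a b z₁ z₂ : Fin 6 → ℝ) :
    z₁ ⬝ᵥ ((Matrix.vecMulVec a b).mulVec z₂) = (z₁ ⬝ᵥ a) * (z₂ ⬝ᵥ b) := by
  rw [Matrix.vecMulVec_mulVec, op_smul_eq_smul, dotProduct_smul, smul_eq_mul, dotProduct_comm z₂ b]
  ring

/-- Bilinear form of a symmetroid Gram `v vᵀ − u uᵀ − w wᵀ`. [folklore] -/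
theorem symmetroidForm_apply (v u w z₁ z₂ : Fin 6 → ℝ) :
    z₁ ⬝ᵥ ((Matrix.vecMulVec v v - Matrix.vecMulVec u u - Matrix.vecMulVec w w).mulVec z₂)
      = (z₁ ⬝ᵥ v) * (z₂ ⬝ᵥ v) - (z₁ ⬝ᵥ u) * (z₂ ⬝ᵥ u) - (z₁ ⬝ᵥ w) * (z₂ ⬝ᵥ w) := by
  simp only [Matrix.sub_mulVec, dotProduct_sub, dot_vecMulVec_mulVec]

/-- **Stub C₁ of the line (`stub_onePositive`, size S), verbatim: a symmetroid Gram has at most one positive eigenvalue.**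
`M = v vᵀ − u uᵀ − w wᵀ ≤ v vᵀ` in the Loewner order: given `x, y` with positive `M`-norm and `xᵀ M y = 0`, the vector
`z = (v⬝y) x − (v⬝x) y` has `v ⬝ z = 0` hence `zᵀ M z ≤ 0`, while bilinearity gives `zᵀ M z = (v⬝y)² xᵀMx + (v⬝x)² yᵀMy > 0`.
(Proof of ideator val-idea-4 g2, line file v3, carried to the Theorems side.) [folklore] -/
theorem stub_onePositive :
    ∀ M : Matrix (Fin 6) (Fin 6) ℝ, IsSymmetroidGram M → ¬ TwoPositive M := by
  rintro M ⟨v, u, w, rfl⟩ ⟨x, y, hx, hy, hxy⟩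
  rw [symmetroidForm_apply] at hx hy hxy
  set α := x ⬝ᵥ v
  set β := y ⬝ᵥ v
  set p := x ⬝ᵥ u
  set p' := y ⬝ᵥ u
  set s := x ⬝ᵥ w
  set s' := y ⬝ᵥ w
  have hα : 0 < α * α := by nlinarith [mul_self_nonneg p, mul_self_nonneg s]
  have h2 : β * β * (α * α - p * p - s * s) + α * α * (β * β - p' * p' - s' * s')
      = -((β * p - α * p') ^ 2 + (β * s - α * s') ^ 2) := by
    linear_combination (2 * α * β) * hxy
  nlinarith [mul_pos hα hy, mul_nonneg (mul_self_nonneg β) hx.le, sq_nonneg (β * p - α * p'),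
    sq_nonneg (β * s - α * s')]

/-- The one-positive lemma under its v3 name `onePositive` (same statement as `stub_onePositive`). [folklore] -/
theorem onePositive :
    ∀ M : Matrix (Fin 6) (Fin 6) ℝ, IsSymmetroidGram M → ¬ TwoPositive M :=
  stub_onePositive

/-! ### 3. The reduction: signature law at `K = 6` ⇒ `DoorA26` -/

/-- `gram S` is a symmetric matrix. [folklore] -/
theorem gram_isSymm (S : Fin 6 → Matrix (Fin 2) (Fin 2) ℝ) : (gram S).IsSymm := by
  unfold Matrix.IsSymm
  ext i j
  simp only [gram, Matrix.transpose_apply, Matrix.of_apply]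
  ring

/-- **The would-be-Gram form of the door under the signature law.**  If every `K = 6` would-be Gram is `TwoPositive`
(the line's bet `stub_signatureLaw6`, taken as a hypothesis), then no would-be Gram is a symmetroid Gram. [folklore] -/
theorem not_isSymmetroidGram_extremalGram_of_signatureLaw6
    (hSIG6 : ∀ (d : Fin 6 → ℕ) (E : Fin 21 → ℕ) (σ : Fin 6 → Fin 6 → Fin 21) (r : Fin 20 → ℝ) (c : ℝ),
      StrictMono E → (∀ i j, σ i j = σ j i) → (∀ i j, E (σ i j) = d i + d j) → (∀ k, ∃ i j, σ i j = k) →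
      StrictMono r → 0 < r 0 → c ≠ 0 → TwoPositive (extremalGram E σ r c)) :
    ∀ (d : Fin 6 → ℕ) (E : Fin 21 → ℕ) (σ : Fin 6 → Fin 6 → Fin 21) (r : Fin 20 → ℝ) (c : ℝ),
      StrictMono E → (∀ i j, σ i j = σ j i) → (∀ i j, E (σ i j) = d i + d j) → (∀ k, ∃ i j, σ i j = k) →
      StrictMono r → 0 < r 0 → c ≠ 0 → ¬ IsSymmetroidGram (extremalGram E σ r c) :=
  fun d E σ r c hE hσ hσE hsurj hr hr0 hc hS => stub_onePositive _ hS (hSIG6 d E σ r c hE hσ hσE hsurj hr hr0 hc)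

/-- **REDUCTION (the line's composition, kernel-checked on the Theorems side): the signature law at `K = 6` implies
`DoorA26`.**  If every would-be Gram `extremalGram E σ r c` on a Sidon support (`E` strictly increasing, `σ` symmetric and
onto with `E (σ i j) = dᵢ + dⱼ`), at sorted positive roots `r` and with `c ≠ 0`, admits two `M`-orthogonal vectors of
positive `M`-norm (`TwoPositive`), then every 6-term real symmetric `2 × 2` lacunary pencil determinant has at most `19`
distinct positive zeros — the route decl `Summit.….Theses.LacunarySymmetroid.DoorA26` BY NAME.  Proof: a pencil with `≥ 20`
positive zeros has `det = gramPoly d (gram S)` (`stub_gramForm`), so `gram S = extremalGram E σ r c` (`stub_extremalInverse`,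
landed), which is `TwoPositive` by the law yet a symmetroid Gram (`stub_gramForm`) — contradiction with `stub_onePositive`.
CONDITIONAL: the hypothesis is the line's OPEN bet `stub_signatureLaw6`; `DoorA26` itself is NOT proved here. [folklore] -/
theorem doorA26_of_signatureLaw6
    (hSIG6 : ∀ (d : Fin 6 → ℕ) (E : Fin 21 → ℕ) (σ : Fin 6 → Fin 6 → Fin 21) (r : Fin 20 → ℝ) (c : ℝ),
      StrictMono E → (∀ i j, σ i j = σ j i) → (∀ i j, E (σ i j) = d i + d j) → (∀ k, ∃ i j, σ i j = k) →
      StrictMono r → 0 < r 0 → c ≠ 0 → TwoPositive (extremalGram E σ r c)) :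
    Summit.ValiantsHypothesis.ValiantsHypothesis.Theses.LacunarySymmetroid.DoorA26 := by
  intro d S hS
  by_contra h
  push Not at h
  obtain ⟨hdet, hgram⟩ := stub_gramForm d S hS
  rw [hdet] at h
  obtain ⟨E, σ, r, c, hE, hσ, hσE, hsurj, hr, hr0, hc, hM⟩ := stub_extremalInverse d (gram S) (gram_isSymm S) h
  exact stub_onePositive _ (hM ▸ hgram) (hSIG6 d E σ r c hE hσ hσE hsurj hr hr0 hc)

end Summit.ValiantsHypothesis.ValiantsHypothesis.Theorems.LacunarySymmetroid.DoorA26.ExtremalInverse
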